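import Literature.NumberTheory.NumberFields.AmbiguousNarrowClassNumberFormula
import Literature.NumberTheory.NumberFields.AmbiguousClassNumberInequality
import Literature.NumberTheory.NumberFields.HasseUnitIndexOddNarrowClassNumber
import HarnessLib

/-!
# The unit index of the narrow ambiguous class number formula: `N_{L/K}(L⁺) = L⁺ ∩ N_{L/K}(Lˣ)` (a totally positive norm from a cyclic
# extension is the norm of a totally positive element), so the index is the printed `[E_K⁺ : E_K⁺ ∩ N_{L/K} Lˣ]`; it is `1` for quadratic
# `L/K` with `h⁺(K)` odd, whence `#Cl⁺(L)^G · 2 = h⁺(K) · 2^t`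

Topic `NumberTheory/NumberFields`; namespace `Literature.NumberTheory.NumberFields.AmbiguousClass`.  THEOREM-ONLY file (no definition, no
named fact, no instance, no `sorry`), written by the prover seat `cruxlead-stmt-BirchSwinnertonDyer-19573-w2` GEN 12 (cell `bsd-2adic`;
`--supports` stmt-BirchSwinnertonDyer-19573; closes nothing).  Companion of `TotallyPositiveHilbert90.lean` / `AmbiguousNarrowClassNumberFormula.lean`:
the narrow formula meets the norm group `N(L⁺)` of the TOTALLY POSITIVE elements, while Gras / Yu print `E_K⁺ ∩ N_{L/K} Lˣ`; the two agree.

THE THEOREM (`map_norm_ker_signHom_eq`).  `L/K` cyclic (Galois, `Gal(L/K) = ⟨σ⟩` of order `n`), `L⁺ = ker(signHom L)`, `N = N_G`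
(`Herbrand.norm`, `= ∏_{i<n} σ^i` on `Lˣ`): **`N(L⁺) = L⁺ ⊓ N(Lˣ)`** — if `x = N(a)` is totally positive then `x = N(a')` with `a'`
totally positive.  PROOF (signature bookkeeping in `𝔽₂`, Fröhlich–Taylor V §1): write `α(ψ) ∈ 𝔽₂` for the sign of `a` at the real
embedding `ψ`.  The real embeddings above a real embedding `ρ` of `K` form ONE `G`-orbit `ψ_ρ ∘ σ^i`, `0 ≤ i < n` (transitivity,
`exists_realEmbedding_comp_algEquiv_eq`; freeness since `ψ_ρ` is injective and `σ` has order `n`), and along it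
`Σ_{i<n} α(ψ_ρ ∘ σ^i) = sign ψ_ρ(N a) = 0`.  Hence the cocycle equation `β(ψ ∘ σ) − β(ψ) = α(ψ)` is solved by the partial sums
`β(ψ_ρ ∘ σ^i) = Σ_{j<i} α(ψ_ρ ∘ σ^j)`; weak approximation (`signHom_surjective`) gives `b ∈ Lˣ` with signature `β`, so that `t = σb/b` has the
signature of `a` and norm `1`, and `a' = a/t` is totally positive with `N(a') = N(a)`.

* `realEmbedding_eq_comp_pow_of_comp_eq` — fibres = orbits, parametrised by `i < n`; `pow_eq_of_comp_pow_eq` — freeness.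
* `exists_signHom_twist_eq` — for `N a ∈ L⁺` there is `b` with `signHom(σb/b) = signHom(a)`.
* ★ `map_norm_ker_signHom_eq` — `N(L⁺) = L⁺ ⊓ N(Lˣ)`; `unitsPos_inf_map_norm_ker_signHom_eq` — `E⁺ ⊓ N(L⁺) = E⁺ ⊓ N(Lˣ)`.
* `ambiguousNarrowClassNumberFormula'` — the formula of Part II with the printed unit index `[E_K⁺ : E_K⁺ ∩ N_G(Lˣ)]`.
* §4 quadratic `L/K` (Galois of degree `2`, `L` totally real) with `h⁺(K)` ODD: `E_K⁺ ⊆ N(Lˣ)` (totally positive units of `K` are squares),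
  the unit index is `1` (`relIndex_unitsPosNorm_eq_one_of_odd_narrowClassNumber`), and ★ **`#Cl⁺(L)^G · 2 = h⁺(K) · ∏ e_𝔭 = h⁺(K) · 2^t`**
  (`relIndex_z0_totPosPrincipalIdeals_mul_two_eq_of_odd_narrowClassNumber`, `…_eq_mul_two_pow`).

References: [Gras2003] II.6.2.3 (restricted sense: the index `(E_K^{res} : E_K^{res} ∩ N L^×)`), IV.4; [Yu2014AmbiguousClassNumberFormulas] Thm. 1.1
(`[𝔬(𝔠)^× : 𝔬(𝔠)^× ∩ N_{K/k}(K^×)]`, held p. 3); [FrohlichTaylor1990] Ch. II (2.14), Ch. V §1 (1.10)–(1.11), pp. 163–164; [Lang1990] Ch. 13 §4.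
-/

noncomputable section

open NumberField NumberField.InfinitePlace
open scoped nonZeroDivisors Pointwise

namespace Literature.NumberTheory.NumberFields.AmbiguousClass

open Literature.NumberTheory.GaloisRepresentations Literature.NumberTheory.GaloisRepresentations.Herbrand
  Literature.NumberTheory.GaloisRepresentations.MinkowskiUnit
  Literature.NumberTheory.GaloisRepresentations.CyclicNormIndex

variable {K L : Type} [Field K] [NumberField K] [Field L] [NumberField L] [Algebra K L]

/-! ### §1 The real embeddings above a real embedding of `K`: one free `G`-orbit `ψ_ρ ∘ σ^i`, `i < n` -/

omit [NumberField K] [NumberField L] in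
/-- Composition of a real embedding with a product of automorphisms: `(ψ ∘ g) ∘ h = ψ ∘ (g h)`. [folklore] -/
private theorem comp_comp_algEquiv (ψ : L →+* ℝ) (g h : L ≃ₐ[K] L) :
    (ψ.comp (g : L →+* L)).comp (h : L →+* L) = ψ.comp ((g * h : L ≃ₐ[K] L) : L →+* L) :=
  RingHom.ext fun _ => rfl

omit [NumberField K] [NumberField L] in
/-- **Fibres are orbits**: if `ψ₀`, `ψ` are real embeddings of `L` with the same restriction to `K` and `Gal(L/K) = ⟨σ⟩` has order `n`, then
`ψ = ψ₀ ∘ σ^i` for some `i < n` (Galois transitivity `exists_realEmbedding_comp_algEquiv_eq` + `σ^k = σ^{k mod n}`).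
[cite: FrohlichTaylor1990, Ch. V §1 (1.11) (real embeddings and signatures), p. 164] [cite: Lang1990, Ch. 13 §4 (PDF p. 203)] -/
theorem realEmbedding_eq_comp_pow_of_comp_eq [IsGalois K L] [Fintype (L ≃ₐ[K] L)] {σ : L ≃ₐ[K] L}
    (hσ : ∀ τ : L ≃ₐ[K] L, τ ∈ Subgroup.zpowers σ) {ψ₀ ψ : L →+* ℝ}
    (h : ψ₀.comp (algebraMap K L) = ψ.comp (algebraMap K L)) :
    ∃ i < orderOf σ, ψ = ψ₀.comp ((σ ^ i : L ≃ₐ[K] L) : L →+* L) := by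
  obtain ⟨τ, hτ⟩ := exists_realEmbedding_comp_algEquiv_eq h
  obtain ⟨k, rfl⟩ := Herbrand.exists_pow_eq_of_forall_mem_zpowers hσ τ
  refine ⟨k % orderOf σ, Nat.mod_lt _ (orderOf_pos σ), ?_⟩
  rw [pow_mod_orderOf, hτ]

omit [NumberField K] [NumberField L] in
/-- **Freeness**: `ψ₀ ∘ σ^i = ψ₀ ∘ σ^j` with `i, j < ord σ` forces `i = j` (a real embedding is injective). [folklore: `pow_injOn_Iio_orderOf`]
[cite: FrohlichTaylor1990, Ch. V §1 (1.11), p. 164] -/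
theorem pow_eq_of_comp_pow_eq {σ : L ≃ₐ[K] L} {ψ₀ : L →+* ℝ} {i j : ℕ} (hi : i < orderOf σ) (hj : j < orderOf σ)
    (h : ψ₀.comp ((σ ^ i : L ≃ₐ[K] L) : L →+* L) = ψ₀.comp ((σ ^ j : L ≃ₐ[K] L) : L →+* L)) : i = j := by
  have hij : σ ^ i = σ ^ j := by
    apply AlgEquiv.ext
    intro x
    exact ψ₀.injective (RingHom.congr_fun h x)
  exact pow_injOn_Iio_orderOf (Set.mem_Iio.mpr hi) (Set.mem_Iio.mpr hj) hij

/-! ### §2 Signatures in `𝔽₂`: the cocycle equation `β(ψ ∘ σ) − β(ψ) = α(ψ)` -/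

omit [NumberField K] [NumberField L] in
/-- The signature of `g • x` at `ψ` is the signature of `x` at `ψ ∘ g`. [cite: FrohlichTaylor1990, Ch. V §1 (1.10), p. 163] -/
theorem toAdd_signHom_smul (g : L ≃ₐ[K] L) (x : Lˣ) (ψ : L →+* ℝ) :
    Multiplicative.toAdd (signHom L (g • x)) ψ = Multiplicative.toAdd (signHom L x) (ψ.comp (g : L →+* L)) := by
  rw [signHom_apply, signHom_apply]
  rfl

omit [NumberField K] [NumberField L] in
/-- The signature of a finite product is the sum of the signatures (`signHom` is a homomorphism into `𝔽₂^{r₁}`).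
[cite: FrohlichTaylor1990, Ch. V §1 (1.10)–(1.11), pp. 163–164] -/
theorem toAdd_signHom_prod {ι : Type*} (s : Finset ι) (f : ι → Lˣ) (ψ : L →+* ℝ) :
    Multiplicative.toAdd (signHom L (∏ i ∈ s, f i)) ψ = ∑ i ∈ s, Multiplicative.toAdd (signHom L (f i)) ψ := by
  classical
  induction s using Finset.induction_on with
  | empty => simp
  | insert i s hi ih =>
    rw [Finset.prod_insert hi, Finset.sum_insert hi, map_mul, toAdd_mul, Pi.add_apply, ih]

/-- **The cocycle is a coboundary on signatures.**  For `L/K` cyclic (`Gal = ⟨σ⟩`) and `a ∈ Lˣ` whose norm `N_G a` is TOTALLY POSITIVE there is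
`b ∈ Lˣ` with `signHom(σb/b) = signHom(a)`: on each orbit `ψ_ρ ∘ σ^i` (`i < n`) of real embeddings put `β(ψ_ρ ∘ σ^i) = Σ_{j<i} α(ψ_ρ ∘ σ^j)`
(`α` = signature of `a`); the orbit sum `Σ_{i<n} α(ψ_ρ ∘ σ^i)` is the signature of `N a` at `ψ_ρ`, i.e. `0`, so `β(ψ∘σ) − β(ψ) = α(ψ)`
everywhere, and `b` with signature `β` exists by weak approximation (`signHom_surjective`).
[cite: FrohlichTaylor1990, Ch. II (2.14), Ch. V §1 (1.10)–(1.11), pp. 163–164] [cite: Yu2014AmbiguousClassNumberFormulas, Thm. 1.1 (the index is taken in `N_{K/k}(K^×)`)] -/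
theorem exists_signHom_twist_eq [IsGalois K L] {σ : L ≃ₐ[K] L}
    (hσ : ∀ τ : L ≃ₐ[K] L, τ ∈ Subgroup.zpowers σ) {a : Lˣ}
    (hNa : Herbrand.norm (L ≃ₐ[K] L) a ∈ (signHom L).ker) :
    ∃ b : Lˣ, signHom L (σ • b / b) = signHom L a := by
  classical
  by_cases hne : Nonempty (L →+* ℝ)
  swap
  · -- no real embedding: every signature is trivial
    refine ⟨1, ?_⟩
    have : ∀ x : Lˣ, signHom L x = 1 := fun x => by
      rw [← MonoidHom.mem_ker, mem_ker_signHom_iff]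
      intro ψ; exact absurd ⟨ψ⟩ hne
    rw [this, this]
  haveI := hne
  set n := orderOf σ with hn
  have hnG : n = Nat.card (L ≃ₐ[K] L) := orderOf_eq_card_of_forall_mem_zpowers hσ
  -- a base point in each fibre
  set base : (K →+* ℝ) → (L →+* ℝ) := fun ρ => Classical.epsilon fun χ : L →+* ℝ => χ.comp (algebraMap K L) = ρ with hbase
  have hbase_spec : ∀ ψ : L →+* ℝ, (base (ψ.comp (algebraMap K L))).comp (algebraMap K L) = ψ.comp (algebraMap K L) :=
    fun ψ => Classical.epsilon_spec (p := fun χ : L →+* ℝ => χ.comp (algebraMap K L) = ψ.comp (algebraMap K L)) ⟨ψ, rfl⟩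
  -- the position of `ψ` in its orbit
  have hex : ∀ ψ : L →+* ℝ, ∃ i < n, ψ = (base (ψ.comp (algebraMap K L))).comp ((σ ^ i : L ≃ₐ[K] L) : L →+* L) :=
    fun ψ => realEmbedding_eq_comp_pow_of_comp_eq hσ (hbase_spec ψ)
  choose idx hidx_lt hidx_eq using hex
  -- uniqueness of the position
  have hidx_unique : ∀ (ψ : L →+* ℝ) (i : ℕ), i < n →
      ψ = (base (ψ.comp (algebraMap K L))).comp ((σ ^ i : L ≃ₐ[K] L) : L →+* L) → idx ψ = i :=
    fun ψ i hi h => pow_eq_of_comp_pow_eq (hidx_lt ψ) hi ((hidx_eq ψ).symm.trans h)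
  -- restriction to `K` along the orbit
  have hres : ∀ (ψ : L →+* ℝ) (g : L ≃ₐ[K] L), (ψ.comp (g : L →+* L)).comp (algebraMap K L) = ψ.comp (algebraMap K L) := by
    intro ψ g; ext x
    simp only [RingHom.comp_apply]
    exact congrArg ψ (g.commutes x)
  -- the signatures
  set α : (L →+* ℝ) → ZMod 2 := fun χ => Multiplicative.toAdd (signHom L a) χ with hα
  set β : (L →+* ℝ) → ZMod 2 := fun ψ =>
    ∑ j ∈ Finset.range (idx ψ), α ((base (ψ.comp (algebraMap K L))).comp ((σ ^ j : L ≃ₐ[K] L) : L →+* L)) with hβ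
  -- the orbit sums vanish: `Σ_{j<n} α(ψ₀ ∘ σ^j) = sign_{ψ₀}(N a) = 0`
  have horbit : ∀ ψ₀ : L →+* ℝ, ∑ j ∈ Finset.range n, α (ψ₀.comp ((σ ^ j : L ≃ₐ[K] L) : L →+* L)) = 0 := by
    intro ψ₀
    have h1 : Multiplicative.toAdd (signHom L (Herbrand.norm (L ≃ₐ[K] L) a)) ψ₀ = 0 := by
      rw [(MonoidHom.mem_ker).mp hNa, toAdd_one, Pi.zero_apply]
    rw [norm_apply, ← prod_range_card_pow_eq_prod hσ (fun g => g • a), ← hnG, toAdd_signHom_prod] at h1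
    rw [← h1]
    refine Finset.sum_congr rfl fun j _ => ?_
    rw [hα, toAdd_signHom_smul]
  -- the cocycle equation
  have hcocycle : ∀ ψ : L →+* ℝ, β (ψ.comp (σ : L →+* L)) = β ψ + α ψ := by
    intro ψ
    set ρ := ψ.comp (algebraMap K L) with hρ
    set i := idx ψ with hi
    have hψ : ψ = (base ρ).comp ((σ ^ i : L ≃ₐ[K] L) : L →+* L) := hidx_eq ψ
    have hρ' : (ψ.comp (σ : L →+* L)).comp (algebraMap K L) = ρ := hres ψ σ
    have hψσ : ψ.comp (σ : L →+* L) = (base ρ).comp ((σ ^ (i + 1) : L ≃ₐ[K] L) : L →+* L) := by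
      conv_lhs => rw [hψ]
      rw [comp_comp_algEquiv, pow_succ]
    by_cases hlast : i + 1 < n
    · -- interior step of the orbit
      have hidx' : idx (ψ.comp (σ : L →+* L)) = i + 1 := hidx_unique _ _ hlast (by rw [hρ']; exact hψσ)
      simp only [hβ, hidx', hρ', Finset.sum_range_succ]
      congr 1
      rw [← hψ]
    · -- wrap-around: `i + 1 = n`, `ψ ∘ σ = base`
      have hi1 : i + 1 = n := le_antisymm (hidx_lt ψ) (not_lt.mp hlast)
      have hψσ' : ψ.comp (σ : L →+* L) = base ρ := by
        rw [hψσ, hi1, hn, pow_orderOf_eq_one]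
        exact RingHom.ext fun _ => rfl
      have hidx' : idx (ψ.comp (σ : L →+* L)) = 0 :=
        hidx_unique _ _ (orderOf_pos σ) (by rw [hρ', pow_zero]; exact hψσ'.trans (RingHom.ext fun _ => rfl))
      have hsum := horbit (base ρ)
      rw [← hi1, Finset.sum_range_succ, ← hψ] at hsum
      -- `β(ψσ) = 0` and `β(ψ) + α(ψ) = 0`
      simp only [hβ, hidx', hρ', Finset.sum_range_zero]
      rw [← hi, hsum.symm]
  -- realise `β` as the signature of some `b`
  obtain ⟨b, hb⟩ := signHom_surjective L (Multiplicative.ofAdd β)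
  refine ⟨b, ?_⟩
  apply Multiplicative.toAdd.injective
  funext ψ
  rw [map_div, toAdd_div, Pi.sub_apply, toAdd_signHom_smul, hb, toAdd_ofAdd, hcocycle]
  simp only [hα, add_sub_cancel_left]

/-! ### §3 `N(L⁺) = L⁺ ∩ N(Lˣ)` -/

/-- **A totally positive norm from a cyclic extension is the norm of a totally positive element: `N_G(L⁺) = L⁺ ⊓ N_G(Lˣ)`** (`L/K` cyclic,
Galois, `Gal = ⟨σ⟩`; `L⁺ = ker(signHom L)`).  `⊆`: `L⁺` is `G`-stable and multiplicatively closed.  `⊇`: for `x = N a ∈ L⁺` take `b` with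
`signHom(σb/b) = signHom(a)` (`exists_signHom_twist_eq`); then `a' = a/(σb/b)` is totally positive and `N a' = N a = x`.  Hence the unit index of the
narrow ambiguous class number formula, met as `[E_K⁺ : E_K⁺ ∩ N(L⁺)]`, is the printed `[E_K⁺ : E_K⁺ ∩ N_{L/K} Lˣ]`.
[cite: Gras2003, II.6.2.3 (restricted sense), IV.4] [cite: Yu2014AmbiguousClassNumberFormulas, Thm. 1.1, p. 3] -/
theorem map_norm_ker_signHom_eq [IsGalois K L] {σ : L ≃ₐ[K] L}
    (hσ : ∀ τ : L ≃ₐ[K] L, τ ∈ Subgroup.zpowers σ) :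
    ((signHom L).ker).map (Herbrand.norm (L ≃ₐ[K] L)) =
      (signHom L).ker ⊓ (⊤ : Subgroup Lˣ).map (Herbrand.norm (L ≃ₐ[K] L)) := by
  apply le_antisymm
  · rintro _ ⟨a, ha, rfl⟩
    exact ⟨isStable_ker_signHom.norm_mem ha, ⟨a, Subgroup.mem_top a, rfl⟩⟩
  · rintro x ⟨hx, ⟨a, -, rfl⟩⟩
    obtain ⟨b, hb⟩ := exists_signHom_twist_eq hσ hx
    refine ⟨a / (σ • b / b), ?_, ?_⟩
    · rw [SetLike.mem_coe, MonoidHom.mem_ker, map_div, hb, div_self']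
    · rw [map_div, ← twist_apply, norm_twist, div_one]

/-- **`E⁺ ∩ N_G(L⁺) = E⁺ ∩ N_G(Lˣ)`** (`E⁺ = 𝓞_Lˣ ∩ L⁺`): the norm subgroup of the narrow ambiguous class number formula in its printed form.
[cite: Gras2003, II.6.2.3 (restricted sense)] [cite: Yu2014AmbiguousClassNumberFormulas, Thm. 1.1, p. 3] -/
theorem unitsPos_inf_map_norm_ker_signHom_eq [IsGalois K L] {σ : L ≃ₐ[K] L}
    (hσ : ∀ τ : L ≃ₐ[K] L, τ ∈ Subgroup.zpowers σ) :
    (unitsE L ⊓ (signHom L).ker) ⊓ ((signHom L).ker).map (Herbrand.norm (L ≃ₐ[K] L)) =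
      (unitsE L ⊓ (signHom L).ker) ⊓ (⊤ : Subgroup Lˣ).map (Herbrand.norm (L ≃ₐ[K] L)) := by
  rw [map_norm_ker_signHom_eq hσ, ← inf_assoc, inf_eq_left.mpr (inf_le_right : unitsE L ⊓ (signHom L).ker ≤ (signHom L).ker)]

/-- **The narrow ambiguous class number formula with the printed unit index** (`L/K` cyclic, `Gal = ⟨σ⟩`, unramified at the infinite
places): `#Cl⁺(L)^G · [L : K] · [E_K⁺ : E_K⁺ ∩ N_G(Lˣ)] = h⁺(K) · ∏_𝔭 e_𝔭` — `ambiguousNarrowClassNumberFormula` rewritten with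
`unitsPos_inf_map_norm_ker_signHom_eq`. [cite: Gras2003, II.6.2.3 (restricted sense), IV.4] [cite: Yu2014AmbiguousClassNumberFormulas, Thm. 1.1, p. 3] -/
theorem ambiguousNarrowClassNumberFormula' [IsGalois K L] [IsUnramifiedAtInfinitePlaces K L] {σ : L ≃ₐ[K] L}
    (hσ : ∀ τ : L ≃ₐ[K] L, τ ∈ Subgroup.zpowers σ) :
    (totPosPrincipalIdeals L).relIndex (z0 σ ⊤ (totPosPrincipalIdeals L)) * Module.finrank K L *
        ((unitsE L ⊓ (signHom L).ker) ⊓ (⊤ : Subgroup Lˣ).map (Herbrand.norm (L ≃ₐ[K] L))).relIndex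
          ((unitsE L ⊓ (signHom L).ker) ⊓ (unitsIncl K L).range) =
      narrowClassNumber K * ∏ᶠ v : IsDedekindDomain.HeightOneSpectrum (𝓞 K), v.asIdeal.ramificationIdxIn (𝓞 L) := by
  rw [← unitsPos_inf_map_norm_ker_signHom_eq hσ]
  exact ambiguousNarrowClassNumberFormula hσ

/-! ### §4 Quadratic `L/K` with `h⁺(K)` odd: the unit index is `1` and `#Cl⁺(L)^G · 2 = h⁺(K) · 2^t` -/

/-- **`h⁺(K)` odd, `[L : K] = 2`, `L` totally real ⟹ every totally positive unit of `K` is a norm from `Lˣ`** (inside `Lˣ`, `L/K` Galois): a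
unit `x = ι(u) ∈ E_K⁺` is totally positive in `K` (every real embedding of `K` extends to `L`), hence the SQUARE of a unit of the totally real `K`
(`h⁺(K)` odd: tree `forall_isSquare_of_totallyPositive_of_odd_narrowClassNumber`, Okazaki's Lemma 15 / Hasse), and
`ι(ε)² = N_{L/K}(ι ε)` (`pow_finrank_mem_map_norm`). [cite: Gras2003, IV.4 (genus theory with signatures)]
[cite: FrohlichTaylor1990, Ch. V §1 (1.12), p. 164] [cite: Lang1990, Ch. 13 §4, proof of Lemma 4.2 (`E^l ⊆` norm group) (PDF p. 204)] -/
theorem unitsPos_inf_range_le_map_norm_of_odd_narrowClassNumber [IsGalois K L] [IsTotallyReal L]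
    (h2 : Module.finrank K L = 2) (hK : Odd (narrowClassNumber K)) :
    (unitsE L ⊓ (signHom L).ker) ⊓ (unitsIncl K L).range ≤ (⊤ : Subgroup Lˣ).map (Herbrand.norm (L ≃ₐ[K] L)) := by
  haveI : Algebra.IsAlgebraic K L := Algebra.IsAlgebraic.of_finite K L
  haveI : IsTotallyReal K := IsTotallyReal.of_algebra K L
  haveI : IsUnramifiedAtInfinitePlaces K L := isUnramifiedAtInfinitePlaces_of_isTotallyReal
  rintro x ⟨⟨hxE, hxP⟩, hxK⟩
  have hx : x ∈ ((unitsIncl K L).comp (Units.map (algebraMap (𝓞 K) K : 𝓞 K →* K))).range := by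
    rw [range_unitsIncl_comp_unitsMap_eq]; exact ⟨hxE, hxK⟩
  obtain ⟨u, rfl⟩ := hx
  -- `u` is totally positive in `K`
  have hpos : ∀ ρ : K →+* ℝ, 0 < ρ ((u : 𝓞 K) : K) := by
    intro ρ
    obtain ⟨ψ, hψ⟩ := exists_realEmbedding_comp_eq_of_isUnramifiedAtInfinitePlaces (K := K) (L := L) ρ
    have h := (mem_ker_signHom_iff L).mp hxP ψ
    rw [MonoidHom.comp_apply, coe_unitsIncl, ← RingHom.comp_apply, hψ] at h
    exact h
  -- hence a square of a unit of `K`, whose image is a norm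
  obtain ⟨ε, hε⟩ := forall_isSquare_of_totallyPositive_of_odd_narrowClassNumber K hK u hpos
  rw [hε, ← pow_two, map_pow, ← h2]
  exact pow_finrank_mem_map_norm ⟨_, rfl⟩

/-- **The unit index of the narrow formula is `1` for totally real quadratic `L/K` with `h⁺(K)` odd** (`L/K` Galois of degree `2`,
`Gal = ⟨σ⟩`): `[E_K⁺ : E_K⁺ ∩ N_G(L⁺)] = 1` (§3: `E⁺ ∩ N(L⁺) = E⁺ ∩ N(Lˣ)`, and `E_K⁺ ⊆ N(Lˣ)`). [cite: Gras2003, IV.4]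
[cite: FrohlichTaylor1990, Ch. V §1 (1.12), p. 164] -/
theorem relIndex_unitsPosNorm_eq_one_of_odd_narrowClassNumber [IsGalois K L] [IsTotallyReal L] {σ : L ≃ₐ[K] L}
    (hσ : ∀ τ : L ≃ₐ[K] L, τ ∈ Subgroup.zpowers σ) (h2 : Module.finrank K L = 2) (hK : Odd (narrowClassNumber K)) :
    ((unitsE L ⊓ (signHom L).ker) ⊓ ((signHom L).ker).map (Herbrand.norm (L ≃ₐ[K] L))).relIndex
        ((unitsE L ⊓ (signHom L).ker) ⊓ (unitsIncl K L).range) = 1 := by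
  rw [unitsPos_inf_map_norm_ker_signHom_eq hσ]
  exact Subgroup.relIndex_eq_one.mpr fun x hx =>
    ⟨hx.1, unitsPos_inf_range_le_map_norm_of_odd_narrowClassNumber h2 hK hx⟩

/-- ★ **Narrow genus number of a totally real quadratic extension over a base with odd narrow class number**: `L/K` Galois of degree `2`
(`Gal = ⟨σ⟩`), `L` totally real, `h⁺(K)` odd ⟹ **`#Cl⁺(L)^G · 2 = h⁺(K) · ∏_𝔭 e_𝔭`** (the narrow formula with unit
index `1`); with `t` ramified finite primes `∏_𝔭 e_𝔭 = 2^t` (`…_eq_mul_two_pow`), i.e. `#Cl⁺(L)^G = h⁺(K) · 2^{t−1}` — the count behind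
«`h⁺(K)` odd and `t ≥ 2` ⟹ `h⁺(L)` even» (tree `even_narrowClassNumber_of_quadratic_of_isTotallyReal_of_odd_narrowClassNumber`).
[cite: Gras2003, IV.4 (genus theory with signatures)] [cite: Yu2014AmbiguousClassNumberFormulas, Thm. 1.1, p. 3] -/
theorem relIndex_z0_totPosPrincipalIdeals_mul_two_eq_of_odd_narrowClassNumber [IsGalois K L] [IsTotallyReal L]
    {σ : L ≃ₐ[K] L} (hσ : ∀ τ : L ≃ₐ[K] L, τ ∈ Subgroup.zpowers σ) (h2 : Module.finrank K L = 2)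
    (hK : Odd (narrowClassNumber K)) :
    (totPosPrincipalIdeals L).relIndex (z0 σ ⊤ (totPosPrincipalIdeals L)) * 2 =
      narrowClassNumber K * ∏ᶠ v : IsDedekindDomain.HeightOneSpectrum (𝓞 K), v.asIdeal.ramificationIdxIn (𝓞 L) := by
  haveI : IsUnramifiedAtInfinitePlaces K L := isUnramifiedAtInfinitePlaces_of_isTotallyReal
  have h := ambiguousNarrowClassNumberFormula hσ
  rwa [h2, relIndex_unitsPosNorm_eq_one_of_odd_narrowClassNumber hσ h2 hK, mul_one] at h

/-- The same with the ramified primes counted: **`#Cl⁺(L)^G · 2 = h⁺(K) · 2^t`**, `t = #{𝔭 : e_𝔭 ≠ 1}` (each ramified prime has `e_𝔭 = 2`).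
[cite: Gras2003, IV.4] [cite: Yu2014AmbiguousClassNumberFormulas, Thm. 1.1, p. 3] -/
theorem relIndex_z0_totPosPrincipalIdeals_mul_two_eq_mul_two_pow [IsGalois K L] [IsTotallyReal L]
    {σ : L ≃ₐ[K] L} (hσ : ∀ τ : L ≃ₐ[K] L, τ ∈ Subgroup.zpowers σ) (h2 : Module.finrank K L = 2)
    (hK : Odd (narrowClassNumber K)) :
    (totPosPrincipalIdeals L).relIndex (z0 σ ⊤ (totPosPrincipalIdeals L)) * 2 =
      narrowClassNumber K *
        2 ^ {v : IsDedekindDomain.HeightOneSpectrum (𝓞 K) | v.asIdeal.ramificationIdxIn (𝓞 L) ≠ 1}.ncard := by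
  rw [relIndex_z0_totPosPrincipalIdeals_mul_two_eq_of_odd_narrowClassNumber hσ h2 hK,
    finprod_ramificationIdxIn_eq_pow_of_prime Nat.prime_two h2]

end Literature.NumberTheory.NumberFields.AmbiguousClass

end
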